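import Summits.Ventures.CertifiedManyBodySolver.Observables.EtaPairingExclusionStrongCouplingMirrors
import Summits.Ventures.CertifiedManyBodySolver.Certificates.HubbardSquare_afhfCap_n1_U12
import HarnessLib

/-!
# η-PAIRING EXCLUSION NEAR HALF FILLING AT STRONG COUPLING: `{U ≥ 12, n ≤ 93/100}`, `{U ≥ 21, n ≤ 19/20}`, `{U ≥ 29, n ≤ 24/25}`
# and their electron-doped mirrors — the derived n-tangent row #534 (BY NAME) against the kernel-checked AF-HF planes `U₀ = 12, 20`

HONEST FRAMING: exclusions in Yang's staggered (η) on-site pair channel where nobody expects order; CTL/dictionary class; REGION-valid at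
zero solves; not a superconductivity verdict; no phase sentence. Crew hubbard-obs (D-0042), seat hubbard-obs-p1 (`prover-hubbard-obs-p1-g16-0`),
PAIRCORR-SDP §24; sixth file of the g16 strong-coupling set. Zero compute; no definition; no `sorry`; the only claim node is the derived
n-tangent row #534 `DerivedNTangentR529SymN.derived_r529_ntangent_sq_U8_msym_tp0` (floor `ℓ₅₂₉ + μ₅₂₉(n − 7/8) ≤ e(8, n)`, transported to
`U ≥ 8` by `energyDensityTT'_anchor_le`); caps unconditional (`afhfCap_n1_U12_plane_decimal`, `afhfCap_n1_U20_plane_decimal`).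

The Quadrants file reaches `n ≤ 23/25` at `U ≥ 8` (plane `U₀ = 10`); closer to half filling the particle–hole tangent slope `(1 − n)/2` is
smaller, so flatter planes (smaller double-occupancy slope `D`) are needed and the threshold in `U` rises: the criterion
`ℓ₅₂₉ + μ₅₂₉(n − 7/8) + U(1 − n)/2 − (K + D·U)` is bilinear in `(U, n)`, increasing in `U` when `D < (1 − n)/2`, decided at the corner
`(U_a, n_b)`:
* **`{U ≥ 12, 0 < n ≤ 93/100}`** — plane `U₀ = 12` (`D = 0.0252 < 0.035`), corner criterion `0.0115`;
* **`{U ≥ 21, 0 < n ≤ 19/20}`** — plane `U₀ = 20` (`D = 0.0096 < 0.025`), corner criterion `0.018`;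
* **`{U ≥ 29, 0 < n ≤ 24/25}`** — plane `U₀ = 20` (`D = 0.0096 < 0.02`), corner criterion `0.0136`;
below `7/8` each region is continued by the density-ray lever (`etaPairing_exclusion_of_margin_at_ge`). Compare the premise-free closed
forms of the first file: `U·(1 − n) > 32/π²` needs `U ≥ 46.4 / 64.9 / 81.1` at `n = 0.93 / 0.95 / 0.96`. Mirrors `n ↦ 2 − n` in §2.
THE STRIP `n → 1`: the undecided couplings at density `n` stay BOUNDED (`W(n) ≤ U ≤ U_q(n)`) but `U_q(n) → ∞` as `n → 1` — a Mott gap at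
half filling (unproved in `d = 2`) is exactly what would bound it uniformly.
References: C. N. Yang, PRL 63 (1989) 2144 [Yang1989]; O. Bratteli, D. W. Robinson, OAQSM 2 (1997) Prop. 5.3.19 [BratteliRobinsonII1997];
V. Bach, E. H. Lieb, J. P. Solovej, J. Stat. Phys. 76 (1994) 3, eq. (2c.36) [BachLiebSolovej1994]; E. H. Lieb, PRL 62 (1989) 1201
[LiebPRL1989]; E. H. Lieb, F. Y. Wu, Physica A 321 (2003) 1, §7 [LiebWuPhysicaA2003]; D. Ruelle, *Statistical Mechanics* (1969) §3.3 [Ruelle1969].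
-/

noncomputable section

namespace Summit.Ventures.CertifiedManyBodySolver.Observables

open Matrix Finset Filter Literature.MathematicalPhysics.QuantumLattice Literature.Probability.LatticeModels
open Literature.MathematicalPhysics.QuantumLattice.HubbardWave0 ThermodynamicLimit
open Summit.Ventures.CertifiedManyBodySolver.Certificates
open scoped ComplexOrder Topology

/-! ### §1 Three bilinear pieces above `23/25` -/

/-- **Slab margin `{12 ≤ U, 7/8 ≤ n ≤ 93/100}`**: `0 < U − 2(((-0.6245268599 + 0.0251768039·U) − (ℓ₅₂₉ + μ₅₂₉(n − 7/8)))/(1 − n)) ≤ U − 2μ₊(n; U)` —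
the #534 floor (BY NAME) transported up in `U` and the kernel-checked AF-HF plane at `U₀ = 12`; bilinear, increasing in `U`, decided at the corner
`(12, 93/100)`. [cite: BachLiebSolovej1994, eq. (2c.36)] [cite: LiebWuPhysicaA2003, §7] [cite: Ruelle1969, §3.3] -/
theorem sub_two_mul_chemPotPlusTT'_pos_n93o100_of_twelve_le
    (h534 : DerivedNTangentR529SymN.derived_r529_ntangent_sq_U8_msym_tp0) {U n : ℝ} (hUa : 12 ≤ U) (hn : 7 / 8 ≤ n)
    (hn' : n ≤ 93 / 100) :
    0 < U - 2 * (((-0.6245268599 + U * 0.0251768039) - (-0.8295699476 + (3943194771219 / 2199023255552 : ℝ) * (n - 7 / 8))) /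
        (1 - n)) ∧
      U - 2 * (((-0.6245268599 + U * 0.0251768039) - (-0.8295699476 + (3943194771219 / 2199023255552 : ℝ) * (n - 7 / 8))) /
        (1 - n)) ≤ U - 2 * chemPotPlusTT' 1 0 U n := by
  have hU : 0 ≤ U := by linarith
  have hU8 : 8 ≤ U := by linarith
  have hn0 : 0 < n := by linarith
  have hn1 : n < 1 := by linarith
  have hℓ := ntangent534_le_energyDensityTT'_of_eight_le h534 hU8 hn0 (by linarith)
  refine ⟨?_, sub_two_mul_chemPotPlusTT'_ge_of_floor_of_cap hU hn0 hn1 hℓ (afhfCap_n1_U12_plane_decimal 0 hU)⟩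
  have h1n : (0 : ℝ) < 1 - n := by linarith
  have key : (12 : ℝ) * (1 - n - 2 * 0.0251768039) ≤ U * (1 - n - 2 * 0.0251768039) := by nlinarith
  have hcrit : ((-0.6245268599 + U * 0.0251768039) -
      (-0.8295699476 + (3943194771219 / 2199023255552 : ℝ) * (n - 7 / 8))) / (1 - n) < U / 2 := by
    rw [div_lt_iff₀ h1n]
    nlinarith
  linarith

/-- **η-PAIRING ODLRO IS ABSENT ON `{U ≥ 12, 0 < n ≤ 93/100}`** (`t' = 0`; node #534 BY NAME, cap unconditional): for every TI ground state
`ω` of density `n`, `M⁻⁴ Re ω(η†_{Λ_M} η_{Λ_M}) → 0` and `Re ω(η†_Λ η_Λ) ≤ 64(|Λ'| − |Λ|)²/(U − 2μ₊(n;U))²`, `U − 2μ₊(n;U) > 0` (on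
`[7/8, 93/100]` by the slab margin, below `7/8` by the density ray from `n₁ = 7/8`). [cite: Yang1989, eqs. (6)–(8)]
[cite: BratteliRobinsonII1997, Prop. 5.3.19] [cite: LiebWuPhysicaA2003, §7] -/
theorem etaPairing_exclusion_n93o100_of_twelve_le
    (h534 : DerivedNTangentR529SymN.derived_r529_ntangent_sq_U8_msym_tp0) {U n : ℝ} (hUa : 12 ≤ U) (hn0 : 0 < n)
    (hn' : n ≤ 93 / 100)
    {ω : InfVolFermionState 2} (hω : ω.IsTranslationInvariant) (hρ : ω.density = n)
    (hme : ω.meanEnergy (hubbardTTPrimeFermionInteraction 1 0 U) 1 = energyDensityTT' 1 0 U n) :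
    0 < U - 2 * chemPotPlusTT' 1 0 U n ∧
    Tendsto (fun M : ℕ =>
        (ω.expect (halfOpenBox 2 M) (etaRaise (fun w : PolySite (halfOpenBox 2 M) => siteStagger (ofLex w.1)) *
          etaLower (fun w : PolySite (halfOpenBox 2 M) => siteStagger (ofLex w.1)))).re / (M : ℝ) ^ 4)
        atTop (𝓝 0) ∧
      ∀ {Λ Λ' : Finset (Site 2)}, Λ ⊆ Λ' → thicken Λ 1 ⊆ Λ' →
        (ω.expect Λ (etaRaise (fun w : PolySite Λ => siteStagger (ofLex w.1)) *
            etaLower (fun w : PolySite Λ => siteStagger (ofLex w.1)))).re ≤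
          64 * ((#Λ' : ℝ) - #Λ) ^ 2 / (U - 2 * chemPotPlusTT' 1 0 U n) ^ 2 := by
  have hU : 0 ≤ U := by linarith
  have hpos : 0 < U - 2 * chemPotPlusTT' 1 0 U n := by
    rcases le_total n (7 / 8) with h78 | h78
    · obtain ⟨hm, hle⟩ := sub_two_mul_chemPotPlusTT'_pos_n93o100_of_twelve_le h534 hUa (le_refl (7 / 8 : ℝ)) (by norm_num)
      exact lt_of_lt_of_le hm (sub_two_mul_chemPotPlusTT'_mono_density hU hn0 h78 (by norm_num) hle)
    · obtain ⟨hm, hle⟩ := sub_two_mul_chemPotPlusTT'_pos_n93o100_of_twelve_le h534 hUa h78 hn'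
      exact lt_of_lt_of_le hm hle
  exact ⟨hpos, etaPairing_exclusion_of_margin hU hn0 (by linarith) hpos le_rfl hω hρ hme⟩

/-- **Slab margin `{21 ≤ U, 7/8 ≤ n ≤ 19/20}`**: `0 < U − 2(((-0.3903458723 + 0.0096395237·U) − (ℓ₅₂₉ + μ₅₂₉(n − 7/8)))/(1 − n)) ≤ U − 2μ₊(n; U)` —
the #534 floor (BY NAME) transported up in `U` and the kernel-checked AF-HF plane at `U₀ = 20`; bilinear, increasing in `U`, decided at the corner
`(21, 19/20)`. [cite: BachLiebSolovej1994, eq. (2c.36)] [cite: LiebWuPhysicaA2003, §7] [cite: Ruelle1969, §3.3] -/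
theorem sub_two_mul_chemPotPlusTT'_pos_n19o20_of_twentyone_le
    (h534 : DerivedNTangentR529SymN.derived_r529_ntangent_sq_U8_msym_tp0) {U n : ℝ} (hUa : 21 ≤ U) (hn : 7 / 8 ≤ n)
    (hn' : n ≤ 19 / 20) :
    0 < U - 2 * (((-0.3903458723 + U * 0.0096395237) - (-0.8295699476 + (3943194771219 / 2199023255552 : ℝ) * (n - 7 / 8))) /
        (1 - n)) ∧
      U - 2 * (((-0.3903458723 + U * 0.0096395237) - (-0.8295699476 + (3943194771219 / 2199023255552 : ℝ) * (n - 7 / 8))) /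
        (1 - n)) ≤ U - 2 * chemPotPlusTT' 1 0 U n := by
  have hU : 0 ≤ U := by linarith
  have hU8 : 8 ≤ U := by linarith
  have hn0 : 0 < n := by linarith
  have hn1 : n < 1 := by linarith
  have hℓ := ntangent534_le_energyDensityTT'_of_eight_le h534 hU8 hn0 (by linarith)
  refine ⟨?_, sub_two_mul_chemPotPlusTT'_ge_of_floor_of_cap hU hn0 hn1 hℓ (afhfCap_n1_U20_plane_decimal 0 hU)⟩
  have h1n : (0 : ℝ) < 1 - n := by linarith
  have key : (21 : ℝ) * (1 - n - 2 * 0.0096395237) ≤ U * (1 - n - 2 * 0.0096395237) := by nlinarith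
  have hcrit : ((-0.3903458723 + U * 0.0096395237) -
      (-0.8295699476 + (3943194771219 / 2199023255552 : ℝ) * (n - 7 / 8))) / (1 - n) < U / 2 := by
    rw [div_lt_iff₀ h1n]
    nlinarith
  linarith

/-- **η-PAIRING ODLRO IS ABSENT ON `{U ≥ 21, 0 < n ≤ 19/20}`** (`t' = 0`; node #534 BY NAME, cap unconditional): for every TI ground state
`ω` of density `n`, `M⁻⁴ Re ω(η†_{Λ_M} η_{Λ_M}) → 0` and `Re ω(η†_Λ η_Λ) ≤ 64(|Λ'| − |Λ|)²/(U − 2μ₊(n;U))²`, `U − 2μ₊(n;U) > 0` (on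
`[7/8, 19/20]` by the slab margin, below `7/8` by the density ray from `n₁ = 7/8`). [cite: Yang1989, eqs. (6)–(8)]
[cite: BratteliRobinsonII1997, Prop. 5.3.19] [cite: LiebWuPhysicaA2003, §7] -/
theorem etaPairing_exclusion_n19o20_of_twentyone_le
    (h534 : DerivedNTangentR529SymN.derived_r529_ntangent_sq_U8_msym_tp0) {U n : ℝ} (hUa : 21 ≤ U) (hn0 : 0 < n)
    (hn' : n ≤ 19 / 20)
    {ω : InfVolFermionState 2} (hω : ω.IsTranslationInvariant) (hρ : ω.density = n)
    (hme : ω.meanEnergy (hubbardTTPrimeFermionInteraction 1 0 U) 1 = energyDensityTT' 1 0 U n) :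
    0 < U - 2 * chemPotPlusTT' 1 0 U n ∧
    Tendsto (fun M : ℕ =>
        (ω.expect (halfOpenBox 2 M) (etaRaise (fun w : PolySite (halfOpenBox 2 M) => siteStagger (ofLex w.1)) *
          etaLower (fun w : PolySite (halfOpenBox 2 M) => siteStagger (ofLex w.1)))).re / (M : ℝ) ^ 4)
        atTop (𝓝 0) ∧
      ∀ {Λ Λ' : Finset (Site 2)}, Λ ⊆ Λ' → thicken Λ 1 ⊆ Λ' →
        (ω.expect Λ (etaRaise (fun w : PolySite Λ => siteStagger (ofLex w.1)) *
            etaLower (fun w : PolySite Λ => siteStagger (ofLex w.1)))).re ≤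
          64 * ((#Λ' : ℝ) - #Λ) ^ 2 / (U - 2 * chemPotPlusTT' 1 0 U n) ^ 2 := by
  have hU : 0 ≤ U := by linarith
  have hpos : 0 < U - 2 * chemPotPlusTT' 1 0 U n := by
    rcases le_total n (7 / 8) with h78 | h78
    · obtain ⟨hm, hle⟩ := sub_two_mul_chemPotPlusTT'_pos_n19o20_of_twentyone_le h534 hUa (le_refl (7 / 8 : ℝ)) (by norm_num)
      exact lt_of_lt_of_le hm (sub_two_mul_chemPotPlusTT'_mono_density hU hn0 h78 (by norm_num) hle)
    · obtain ⟨hm, hle⟩ := sub_two_mul_chemPotPlusTT'_pos_n19o20_of_twentyone_le h534 hUa h78 hn'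
      exact lt_of_lt_of_le hm hle
  exact ⟨hpos, etaPairing_exclusion_of_margin hU hn0 (by linarith) hpos le_rfl hω hρ hme⟩

/-- **Slab margin `{29 ≤ U, 7/8 ≤ n ≤ 24/25}`**: `0 < U − 2(((-0.3903458723 + 0.0096395237·U) − (ℓ₅₂₉ + μ₅₂₉(n − 7/8)))/(1 − n)) ≤ U − 2μ₊(n; U)` —
the #534 floor (BY NAME) transported up in `U` and the kernel-checked AF-HF plane at `U₀ = 20`; bilinear, increasing in `U`, decided at the corner
`(29, 24/25)`. [cite: BachLiebSolovej1994, eq. (2c.36)] [cite: LiebWuPhysicaA2003, §7] [cite: Ruelle1969, §3.3] -/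
theorem sub_two_mul_chemPotPlusTT'_pos_n24o25_of_twentynine_le
    (h534 : DerivedNTangentR529SymN.derived_r529_ntangent_sq_U8_msym_tp0) {U n : ℝ} (hUa : 29 ≤ U) (hn : 7 / 8 ≤ n)
    (hn' : n ≤ 24 / 25) :
    0 < U - 2 * (((-0.3903458723 + U * 0.0096395237) - (-0.8295699476 + (3943194771219 / 2199023255552 : ℝ) * (n - 7 / 8))) /
        (1 - n)) ∧
      U - 2 * (((-0.3903458723 + U * 0.0096395237) - (-0.8295699476 + (3943194771219 / 2199023255552 : ℝ) * (n - 7 / 8))) /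
        (1 - n)) ≤ U - 2 * chemPotPlusTT' 1 0 U n := by
  have hU : 0 ≤ U := by linarith
  have hU8 : 8 ≤ U := by linarith
  have hn0 : 0 < n := by linarith
  have hn1 : n < 1 := by linarith
  have hℓ := ntangent534_le_energyDensityTT'_of_eight_le h534 hU8 hn0 (by linarith)
  refine ⟨?_, sub_two_mul_chemPotPlusTT'_ge_of_floor_of_cap hU hn0 hn1 hℓ (afhfCap_n1_U20_plane_decimal 0 hU)⟩
  have h1n : (0 : ℝ) < 1 - n := by linarith
  have key : (29 : ℝ) * (1 - n - 2 * 0.0096395237) ≤ U * (1 - n - 2 * 0.0096395237) := by nlinarith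
  have hcrit : ((-0.3903458723 + U * 0.0096395237) -
      (-0.8295699476 + (3943194771219 / 2199023255552 : ℝ) * (n - 7 / 8))) / (1 - n) < U / 2 := by
    rw [div_lt_iff₀ h1n]
    nlinarith
  linarith

/-- **η-PAIRING ODLRO IS ABSENT ON `{U ≥ 29, 0 < n ≤ 24/25}`** (`t' = 0`; node #534 BY NAME, cap unconditional): for every TI ground state
`ω` of density `n`, `M⁻⁴ Re ω(η†_{Λ_M} η_{Λ_M}) → 0` and `Re ω(η†_Λ η_Λ) ≤ 64(|Λ'| − |Λ|)²/(U − 2μ₊(n;U))²`, `U − 2μ₊(n;U) > 0` (on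
`[7/8, 24/25]` by the slab margin, below `7/8` by the density ray from `n₁ = 7/8`). [cite: Yang1989, eqs. (6)–(8)]
[cite: BratteliRobinsonII1997, Prop. 5.3.19] [cite: LiebWuPhysicaA2003, §7] -/
theorem etaPairing_exclusion_n24o25_of_twentynine_le
    (h534 : DerivedNTangentR529SymN.derived_r529_ntangent_sq_U8_msym_tp0) {U n : ℝ} (hUa : 29 ≤ U) (hn0 : 0 < n)
    (hn' : n ≤ 24 / 25)
    {ω : InfVolFermionState 2} (hω : ω.IsTranslationInvariant) (hρ : ω.density = n)
    (hme : ω.meanEnergy (hubbardTTPrimeFermionInteraction 1 0 U) 1 = energyDensityTT' 1 0 U n) :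
    0 < U - 2 * chemPotPlusTT' 1 0 U n ∧
    Tendsto (fun M : ℕ =>
        (ω.expect (halfOpenBox 2 M) (etaRaise (fun w : PolySite (halfOpenBox 2 M) => siteStagger (ofLex w.1)) *
          etaLower (fun w : PolySite (halfOpenBox 2 M) => siteStagger (ofLex w.1)))).re / (M : ℝ) ^ 4)
        atTop (𝓝 0) ∧
      ∀ {Λ Λ' : Finset (Site 2)}, Λ ⊆ Λ' → thicken Λ 1 ⊆ Λ' →
        (ω.expect Λ (etaRaise (fun w : PolySite Λ => siteStagger (ofLex w.1)) *
            etaLower (fun w : PolySite Λ => siteStagger (ofLex w.1)))).re ≤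
          64 * ((#Λ' : ℝ) - #Λ) ^ 2 / (U - 2 * chemPotPlusTT' 1 0 U n) ^ 2 := by
  have hU : 0 ≤ U := by linarith
  have hpos : 0 < U - 2 * chemPotPlusTT' 1 0 U n := by
    rcases le_total n (7 / 8) with h78 | h78
    · obtain ⟨hm, hle⟩ := sub_two_mul_chemPotPlusTT'_pos_n24o25_of_twentynine_le h534 hUa (le_refl (7 / 8 : ℝ)) (by norm_num)
      exact lt_of_lt_of_le hm (sub_two_mul_chemPotPlusTT'_mono_density hU hn0 h78 (by norm_num) hle)
    · obtain ⟨hm, hle⟩ := sub_two_mul_chemPotPlusTT'_pos_n24o25_of_twentynine_le h534 hUa h78 hn'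
      exact lt_of_lt_of_le hm hle
  exact ⟨hpos, etaPairing_exclusion_of_margin hU hn0 (by linarith) hpos le_rfl hω hρ hme⟩

/-! ### §2 The electron-doped mirrors -/

/-- **η-PAIRING ODLRO IS ABSENT ON `{U ≥ 12, 107/100 ≤ n < 2}`** (mirror of `{U ≥ 12, n ≤ 93/100}`; node #534 BY NAME): bound
`64(|Λ'| − |Λ|)²/(U − 2μ₊(2 − n; U))² + (n − 1)|Λ|`, with `U − 2μ₊(2 − n; U) > 0`. [cite: LiebPRL1989, proof of Theorem 2]
[cite: Yang1989, eqs. (6)–(8)] [cite: BratteliRobinsonII1997, Prop. 5.3.19] -/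
theorem etaPairing_exclusion_n107o100_of_twelve_le_electronDoped
    (h534 : DerivedNTangentR529SymN.derived_r529_ntangent_sq_U8_msym_tp0) {U n : ℝ} (hUa : 12 ≤ U) (hn : 107 / 100 ≤ n)
    (hn2 : n < 2)
    {ω : InfVolFermionState 2} (hω : ω.IsTranslationInvariant) (hρ : ω.density = n)
    (hme : ω.meanEnergy (hubbardTTPrimeFermionInteraction 1 0 U) 1 = energyDensityTT' 1 0 U n) :
    0 < U - 2 * chemPotPlusTT' 1 0 U (2 - n) ∧
    Tendsto (fun M : ℕ =>
        (ω.expect (halfOpenBox 2 M) (etaRaise (fun w : PolySite (halfOpenBox 2 M) => siteStagger (ofLex w.1)) *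
          etaLower (fun w : PolySite (halfOpenBox 2 M) => siteStagger (ofLex w.1)))).re / (M : ℝ) ^ 4)
        atTop (𝓝 0) ∧
      ∀ {Λ Λ' : Finset (Site 2)}, Λ ⊆ Λ' → thicken Λ 1 ⊆ Λ' →
        (ω.expect Λ (etaRaise (fun w : PolySite Λ => siteStagger (ofLex w.1)) *
            etaLower (fun w : PolySite Λ => siteStagger (ofLex w.1)))).re ≤
          64 * ((#Λ' : ℝ) - #Λ) ^ 2 / (U - 2 * chemPotPlusTT' 1 0 U (2 - n)) ^ 2 + (n - 1) * #Λ := by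
  have hU : 0 ≤ U := by linarith
  have hm0 : 0 < 2 - n := by linarith
  have hm2 : 2 - n < 2 := by linarith
  have hm' : 2 - n ≤ 93 / 100 := by linarith
  have hpos : 0 < U - 2 * chemPotPlusTT' 1 0 U (2 - n) := by
    rcases le_total (2 - n) (7 / 8) with h78 | h78
    · obtain ⟨hm, hle⟩ := sub_two_mul_chemPotPlusTT'_pos_n93o100_of_twelve_le h534 hUa (le_refl (7 / 8 : ℝ)) (by norm_num)
      exact lt_of_lt_of_le hm (sub_two_mul_chemPotPlusTT'_mono_density hU hm0 h78 (by norm_num) hle)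
    · obtain ⟨hm, hle⟩ := sub_two_mul_chemPotPlusTT'_pos_n93o100_of_twelve_le h534 hUa h78 hm'
      exact lt_of_lt_of_le hm hle
  have h := etaPairing_exclusion_mirror (c := U - 2 * chemPotPlusTT' 1 0 U (2 - n)) hU hm0 hm2
    (fun hω' hρ' hme' => (etaPairing_exclusion_n93o100_of_twelve_le h534 hUa hm0 hm' hω' hρ' hme').2)
    (ω := ω) hω (by rw [hρ]; ring) (by rw [hme]; congr 1; ring)
  rw [show (1 : ℝ) - (2 - n) = n - 1 by ring] at h
  exact ⟨hpos, h⟩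

/-- **η-PAIRING ODLRO IS ABSENT ON `{U ≥ 21, 21/20 ≤ n < 2}`** (mirror of `{U ≥ 21, n ≤ 19/20}`; node #534 BY NAME): bound
`64(|Λ'| − |Λ|)²/(U − 2μ₊(2 − n; U))² + (n − 1)|Λ|`, with `U − 2μ₊(2 − n; U) > 0`. [cite: LiebPRL1989, proof of Theorem 2]
[cite: Yang1989, eqs. (6)–(8)] [cite: BratteliRobinsonII1997, Prop. 5.3.19] -/
theorem etaPairing_exclusion_n21o20_of_twentyone_le_electronDoped
    (h534 : DerivedNTangentR529SymN.derived_r529_ntangent_sq_U8_msym_tp0) {U n : ℝ} (hUa : 21 ≤ U) (hn : 21 / 20 ≤ n)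
    (hn2 : n < 2)
    {ω : InfVolFermionState 2} (hω : ω.IsTranslationInvariant) (hρ : ω.density = n)
    (hme : ω.meanEnergy (hubbardTTPrimeFermionInteraction 1 0 U) 1 = energyDensityTT' 1 0 U n) :
    0 < U - 2 * chemPotPlusTT' 1 0 U (2 - n) ∧
    Tendsto (fun M : ℕ =>
        (ω.expect (halfOpenBox 2 M) (etaRaise (fun w : PolySite (halfOpenBox 2 M) => siteStagger (ofLex w.1)) *
          etaLower (fun w : PolySite (halfOpenBox 2 M) => siteStagger (ofLex w.1)))).re / (M : ℝ) ^ 4)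
        atTop (𝓝 0) ∧
      ∀ {Λ Λ' : Finset (Site 2)}, Λ ⊆ Λ' → thicken Λ 1 ⊆ Λ' →
        (ω.expect Λ (etaRaise (fun w : PolySite Λ => siteStagger (ofLex w.1)) *
            etaLower (fun w : PolySite Λ => siteStagger (ofLex w.1)))).re ≤
          64 * ((#Λ' : ℝ) - #Λ) ^ 2 / (U - 2 * chemPotPlusTT' 1 0 U (2 - n)) ^ 2 + (n - 1) * #Λ := by
  have hU : 0 ≤ U := by linarith
  have hm0 : 0 < 2 - n := by linarith
  have hm2 : 2 - n < 2 := by linarith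
  have hm' : 2 - n ≤ 19 / 20 := by linarith
  have hpos : 0 < U - 2 * chemPotPlusTT' 1 0 U (2 - n) := by
    rcases le_total (2 - n) (7 / 8) with h78 | h78
    · obtain ⟨hm, hle⟩ := sub_two_mul_chemPotPlusTT'_pos_n19o20_of_twentyone_le h534 hUa (le_refl (7 / 8 : ℝ)) (by norm_num)
      exact lt_of_lt_of_le hm (sub_two_mul_chemPotPlusTT'_mono_density hU hm0 h78 (by norm_num) hle)
    · obtain ⟨hm, hle⟩ := sub_two_mul_chemPotPlusTT'_pos_n19o20_of_twentyone_le h534 hUa h78 hm'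
      exact lt_of_lt_of_le hm hle
  have h := etaPairing_exclusion_mirror (c := U - 2 * chemPotPlusTT' 1 0 U (2 - n)) hU hm0 hm2
    (fun hω' hρ' hme' => (etaPairing_exclusion_n19o20_of_twentyone_le h534 hUa hm0 hm' hω' hρ' hme').2)
    (ω := ω) hω (by rw [hρ]; ring) (by rw [hme]; congr 1; ring)
  rw [show (1 : ℝ) - (2 - n) = n - 1 by ring] at h
  exact ⟨hpos, h⟩

/-- **η-PAIRING ODLRO IS ABSENT ON `{U ≥ 29, 26/25 ≤ n < 2}`** (mirror of `{U ≥ 29, n ≤ 24/25}`; node #534 BY NAME): bound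
`64(|Λ'| − |Λ|)²/(U − 2μ₊(2 − n; U))² + (n − 1)|Λ|`, with `U − 2μ₊(2 − n; U) > 0`. [cite: LiebPRL1989, proof of Theorem 2]
[cite: Yang1989, eqs. (6)–(8)] [cite: BratteliRobinsonII1997, Prop. 5.3.19] -/
theorem etaPairing_exclusion_n26o25_of_twentynine_le_electronDoped
    (h534 : DerivedNTangentR529SymN.derived_r529_ntangent_sq_U8_msym_tp0) {U n : ℝ} (hUa : 29 ≤ U) (hn : 26 / 25 ≤ n)
    (hn2 : n < 2)
    {ω : InfVolFermionState 2} (hω : ω.IsTranslationInvariant) (hρ : ω.density = n)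
    (hme : ω.meanEnergy (hubbardTTPrimeFermionInteraction 1 0 U) 1 = energyDensityTT' 1 0 U n) :
    0 < U - 2 * chemPotPlusTT' 1 0 U (2 - n) ∧
    Tendsto (fun M : ℕ =>
        (ω.expect (halfOpenBox 2 M) (etaRaise (fun w : PolySite (halfOpenBox 2 M) => siteStagger (ofLex w.1)) *
          etaLower (fun w : PolySite (halfOpenBox 2 M) => siteStagger (ofLex w.1)))).re / (M : ℝ) ^ 4)
        atTop (𝓝 0) ∧
      ∀ {Λ Λ' : Finset (Site 2)}, Λ ⊆ Λ' → thicken Λ 1 ⊆ Λ' →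
        (ω.expect Λ (etaRaise (fun w : PolySite Λ => siteStagger (ofLex w.1)) *
            etaLower (fun w : PolySite Λ => siteStagger (ofLex w.1)))).re ≤
          64 * ((#Λ' : ℝ) - #Λ) ^ 2 / (U - 2 * chemPotPlusTT' 1 0 U (2 - n)) ^ 2 + (n - 1) * #Λ := by
  have hU : 0 ≤ U := by linarith
  have hm0 : 0 < 2 - n := by linarith
  have hm2 : 2 - n < 2 := by linarith
  have hm' : 2 - n ≤ 24 / 25 := by linarith
  have hpos : 0 < U - 2 * chemPotPlusTT' 1 0 U (2 - n) := by
    rcases le_total (2 - n) (7 / 8) with h78 | h78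
    · obtain ⟨hm, hle⟩ := sub_two_mul_chemPotPlusTT'_pos_n24o25_of_twentynine_le h534 hUa (le_refl (7 / 8 : ℝ)) (by norm_num)
      exact lt_of_lt_of_le hm (sub_two_mul_chemPotPlusTT'_mono_density hU hm0 h78 (by norm_num) hle)
    · obtain ⟨hm, hle⟩ := sub_two_mul_chemPotPlusTT'_pos_n24o25_of_twentynine_le h534 hUa h78 hm'
      exact lt_of_lt_of_le hm hle
  have h := etaPairing_exclusion_mirror (c := U - 2 * chemPotPlusTT' 1 0 U (2 - n)) hU hm0 hm2
    (fun hω' hρ' hme' => (etaPairing_exclusion_n24o25_of_twentynine_le h534 hUa hm0 hm' hω' hρ' hme').2)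
    (ω := ω) hω (by rw [hρ]; ring) (by rw [hme]; congr 1; ring)
  rw [show (1 : ℝ) - (2 - n) = n - 1 by ring] at h
  exact ⟨hpos, h⟩

end Summit.Ventures.CertifiedManyBodySolver.Observables
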